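import Literature.NumberTheory.Automorphic.CuspTowerColumn
import HarnessLib

/-!
# The inductive step of the cusp invariant of the Fourier–Whittaker tower
(Cogdell, *Analytic theory of L-functions for GL_n* (2004), §1.1, proof of Thm. 1.1: "`φ_e` is
again cuspidal along the unipotent radicals inside the mirabolic")

Topic `NumberTheory/Automorphic`; namespace `Literature.NumberTheory.Automorphic`. Sequel to
`CuspTowerTransport` and `CuspTowerColumn`. The mean-square Fourier–Whittaker tower passes from a
function `φ` on `GL_n(𝔸_K)` to its column coefficient `Φ = φ_e = colCoeff (c + 1 ≤ n) ν φ e` along the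
last column `u : 𝔸_K^{c+1} → GL_n` of the corner `GL_{c+2}`. The stage identity at the next column
size needs the vanishing of a constant term of `Φ`; the invariant that propagates is
`TowerCusp (c ≤ n) ·` ("all block constant terms inside the corner `GL_c` vanish",
`CuspTowerTransport`). This file proves **the inductive step**

* `towerCusp_colCoeff` : `TowerCusp (c + 2 ≤ n) φ → TowerCusp (c + 1 ≤ n) (colCoeff (c + 1 ≤ n) ν φ e)`

for `φ` continuous and left invariant under the rational column group `u(K^{c+1})`.

The proof is the classical manipulation, made explicit in box coordinates. Fix `0 < k < c + 1` and
split a column vector `v = (a, w)` into its rows `< k` and `≥ k` (`rowGlue`). For a block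
`N ∈ 𝔫_k(GL_{c+1})` one has the matrix identity (`colUnipotent_rowGlue_mul_glCorner`)
`u(a, w) · diag(1 + N, 1) = (1 + [N, a - t(N, w)]) · u(0, w)`, where `[N, b] ∈ 𝔫_k(GL_{c+2})` is the
block `N` with the extra column `b` (`blockGlue`) and `t(N, w)_i = ∑_{j ≥ k} N_{ij} w_j`
(`blockTransl`). Hence the block constant term of `Φ` at `y` along `𝔫_k(GL_{c+1})` is an iterated
integral `∫_N ∫_w conj ψ(w_c) ∫_a φ((1 + [N, a - t(N, w)]) u(0, w) y)`; the `a`-integral is unchanged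
by the translation `t(N, w)` (periodicity under `u(K^{c+1})`, `setIntegral_piFundamentalDomain_comp_add`),
and after exchanging the `N`- and `w`-integrals (Fubini on finite boxes, continuous integrands) the
inner `∫_N ∫_a φ((1 + [N, a]) z) = blockCT (c + 2 ≤ n) k ν₂ φ z` vanishes by hypothesis, for the Haar
measure `ν₂` transported along `blockGlue`. Independence of `colCoeff` from the Haar measure
(`colCoeff_eq_of_isAddHaarMeasure`) lets us use a product measure on `𝔸_K^{c+1} = 𝔸^{<k} × 𝔸^{≥k}`.

Contents:

* `RowBelow`, `RowFrom`, `rowGlue` (**definitions**, the row splitting `𝔸^{c+1} ≃ 𝔸^{<k} × 𝔸^{≥k}`),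
  `blockGlue` (**definition**, `𝔫_k(GL_{c+2}) ≃ 𝔫_k(GL_{c+1}) × (column c+1, rows < k)` in box
  coordinates), `blockTransl` (**definition**, the translation `t(N, w)`), their homeomorphism
  versions and the box preimage lemmas;
* matrix identities: `coe_glCorner_mul_colUnipotent`, `blockMatrixEquiv_mulVec_rowGlue`,
  `unipotentOfBlock_blockGlue`, `glCorner_unipotentOfBlock_blockGlue`,
  `colUnipotent_rowGlue_mul_glCorner`, `glCorner_unipotentOfBlock_blockGlue_add`;
* `towerCusp_colCoeff` (**the inductive step**).

## References

* J. W. Cogdell, in Bernstein–Gelbart (eds.), *An Introduction to the Langlands Program* (2004),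
  §1.1 [CogdellAnalyticTheory2004].
* A. Borel, H. Jacquet, Corvallis (1979), §4.4 [BorelJacquet1979].
-/

noncomputable section

open scoped Matrix ComplexConjugate ENNReal NNReal Pointwise
open NumberField IsDedekindDomain MeasureTheory Function
open Literature.LinearAlgebra.Matrix

namespace Literature.NumberTheory.Automorphic

/-! ### Splitting the rows of a column at height `k` -/

section Rows

variable (R : Type*) [CommRing R] (c k : ℕ)

/-- The rows `< k` of a column of size `c + 1`. [folklore] -/
abbrev RowBelow : Type := {i : Fin (c + 1) // (i : ℕ) < k}

/-- The rows `≥ k` of a column of size `c + 1`. [folklore] -/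
abbrev RowFrom : Type := {i : Fin (c + 1) // ¬(i : ℕ) < k}

/-- **Gluing rows**: `(a, w) ↦ v` with `v_i = a_i` for `i < k` and `v_i = w_i` for `i ≥ k` (the
inverse of Mathlib's `Equiv.piEquivPiSubtypeProd`), as an additive equivalence
`R^{<k} × R^{≥k} ≃+ R^{c+1}`. [folklore] -/
def rowGlue : (RowBelow c k → R) × (RowFrom c k → R) ≃+ (Fin (c + 1) → R) where
  toFun q i := if h : (i : ℕ) < k then q.1 ⟨i, h⟩ else q.2 ⟨i, h⟩
  invFun v := (fun i => v i, fun i => v i)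
  left_inv q := Prod.ext (funext fun i => by simp [dif_pos i.2]) (funext fun i => by simp [dif_neg i.2])
  right_inv v := funext fun i => by
    simp only
    split_ifs <;> rfl
  map_add' q q' := funext fun i => by
    simp only [Prod.fst_add, Prod.snd_add, Pi.add_apply]
    split_ifs <;> rfl

variable {R c k} in
/-- Unfolding of `rowGlue`. [folklore] -/
theorem rowGlue_apply (q : (RowBelow c k → R) × (RowFrom c k → R)) (i : Fin (c + 1)) :
    rowGlue R c k q i = if h : (i : ℕ) < k then q.1 ⟨i, h⟩ else q.2 ⟨i, h⟩ := rfl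

variable {R c k} in
/-- `rowGlue` on a row `< k`. [folklore] -/
theorem rowGlue_apply_of_lt (q : (RowBelow c k → R) × (RowFrom c k → R)) (i : Fin (c + 1))
    (h : (i : ℕ) < k) : rowGlue R c k q i = q.1 ⟨i, h⟩ := dif_pos h

variable {R c k} in
/-- `rowGlue` on a row `≥ k`. [folklore] -/
theorem rowGlue_apply_of_not_lt (q : (RowBelow c k → R) × (RowFrom c k → R)) (i : Fin (c + 1))
    (h : ¬(i : ℕ) < k) : rowGlue R c k q i = q.2 ⟨i, h⟩ := dif_neg h

variable [TopologicalSpace R]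

/-- `rowGlue` is continuous. [folklore] -/
theorem continuous_rowGlue : Continuous (rowGlue R c k) := by
  refine continuous_pi fun i => ?_
  by_cases hi : (i : ℕ) < k
  · simp only [rowGlue_apply, dif_pos hi]; exact (continuous_apply _).comp continuous_fst
  · simp only [rowGlue_apply, dif_neg hi]; exact (continuous_apply _).comp continuous_snd

/-- Its inverse is continuous. [folklore] -/
theorem continuous_rowGlue_symm : Continuous (rowGlue R c k).symm :=
  Continuous.prodMk (continuous_pi fun _ => continuous_apply _) (continuous_pi fun _ => continuous_apply _)

/-- `rowGlue` as a homeomorphism. [folklore] -/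
def rowGlueHomeomorph : (RowBelow c k → R) × (RowFrom c k → R) ≃ₜ (Fin (c + 1) → R) where
  toEquiv := (rowGlue R c k).toEquiv
  continuous_toFun := continuous_rowGlue R c k
  continuous_invFun := continuous_rowGlue_symm R c k

end Rows

/-! ### Gluing a block of `GL_{c+1}` and a short column into a block of `GL_{c+2}` -/

section Glue

variable (R : Type*) [CommRing R] (c k : ℕ)

/-- The row index of an index of the block `𝔫_k ≤ M_{c+2}` is `< c + 1`. [folklore] -/
theorem BlockIdx.fst_lt_succ (q : BlockIdx (c + 2) k) : ((q.1.1 : Fin (c + 2)) : ℕ) < c + 1 := by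
  obtain ⟨⟨i, j⟩, h1, h2⟩ := q
  have := j.isLt
  simp only at h1 h2 ⊢
  omega

/-- **Gluing blocks**: for `k ≤ c + 1`, a block `N ∈ R^{BlockIdx (c+1) k}` of `GL_{c+1}` and a short
column `b ∈ R^{<k}` glue to the block `[N, b] ∈ R^{BlockIdx (c+2) k}` of `GL_{c+2}` (`N` in the
columns `< c + 1`, `b` in the column `c + 1`), an additive equivalence. [folklore] -/
def blockGlue (hk : k ≤ c + 1) :
    (BlockIdx (c + 1) k → R) × (RowBelow c k → R) ≃+ (BlockIdx (c + 2) k → R) where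
  toFun q p :=
    if hJ : ((p.1.2 : Fin (c + 2)) : ℕ) < c + 1 then
      q.1 ⟨(⟨p.1.1, BlockIdx.fst_lt_succ c k p⟩, ⟨p.1.2, hJ⟩), p.2⟩
    else q.2 ⟨⟨p.1.1, BlockIdx.fst_lt_succ c k p⟩, p.2.1⟩
  invFun M :=
    (fun p => M ⟨(Fin.castSucc p.1.1, Fin.castSucc p.1.2), p.2⟩,
      fun i => M ⟨(Fin.castSucc i.1, Fin.last (c + 1)), i.2, hk⟩)
  left_inv q := by
    refine Prod.ext (funext fun p => ?_) (funext fun i => ?_)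
    · obtain ⟨⟨i, j⟩, hp⟩ := p
      simp [j.isLt]
    · obtain ⟨i, hi⟩ := i
      simp
  right_inv M := by
    funext p
    obtain ⟨⟨i, j⟩, hi, hj⟩ := p
    by_cases hJ : (j : ℕ) < c + 1
    · simp only [dif_pos hJ, Fin.castSucc_mk, Fin.eta]
    · simp only [dif_neg hJ]
      congr 1
      refine Subtype.ext (Prod.ext (Fin.ext rfl) (Fin.ext ?_))
      have := j.isLt
      simp only [Fin.val_last]
      omega
  map_add' q q' := funext fun p => by
    simp only [Prod.fst_add, Prod.snd_add, Pi.add_apply]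
    split_ifs <;> rfl

variable {R c k}

/-- Unfolding of `blockGlue`. [folklore] -/
theorem blockGlue_apply (hk : k ≤ c + 1) (q : (BlockIdx (c + 1) k → R) × (RowBelow c k → R))
    (p : BlockIdx (c + 2) k) :
    blockGlue R c k hk q p =
      if hJ : ((p.1.2 : Fin (c + 2)) : ℕ) < c + 1 then
        q.1 ⟨(⟨p.1.1, BlockIdx.fst_lt_succ c k p⟩, ⟨p.1.2, hJ⟩), p.2⟩
      else q.2 ⟨⟨p.1.1, BlockIdx.fst_lt_succ c k p⟩, p.2.1⟩ :=
  rfl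

/-- `blockGlue` on the old block. [folklore] -/
theorem blockGlue_apply_castSucc (hk : k ≤ c + 1) (q : (BlockIdx (c + 1) k → R) × (RowBelow c k → R))
    (p : BlockIdx (c + 1) k) :
    blockGlue R c k hk q ⟨(Fin.castSucc p.1.1, Fin.castSucc p.1.2), p.2⟩ = q.1 p := by
  have := congrArg (fun x => x.1 p) ((blockGlue R c k hk).symm_apply_apply q)
  exact this

/-- `blockGlue` on the new column. [folklore] -/
theorem blockGlue_apply_last (hk : k ≤ c + 1) (q : (BlockIdx (c + 1) k → R) × (RowBelow c k → R))
    (i : RowBelow c k) :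
    blockGlue R c k hk q ⟨(Fin.castSucc i.1, Fin.last (c + 1)), i.2, hk⟩ = q.2 i := by
  have := congrArg (fun x => x.2 i) ((blockGlue R c k hk).symm_apply_apply q)
  exact this

variable (R c k) in
/-- `blockGlue` is continuous. [folklore] -/
theorem continuous_blockGlue [TopologicalSpace R] (hk : k ≤ c + 1) : Continuous (blockGlue R c k hk) := by
  refine continuous_pi fun p => ?_
  by_cases hJ : ((p.1.2 : Fin (c + 2)) : ℕ) < c + 1
  · simp only [blockGlue_apply, dif_pos hJ]; exact (continuous_apply _).comp continuous_fst
  · simp only [blockGlue_apply, dif_neg hJ]; exact (continuous_apply _).comp continuous_snd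

variable (R c k) in
/-- Its inverse is continuous. [folklore] -/
theorem continuous_blockGlue_symm [TopologicalSpace R] (hk : k ≤ c + 1) :
    Continuous (blockGlue R c k hk).symm :=
  Continuous.prodMk (continuous_pi fun _ => continuous_apply _) (continuous_pi fun _ => continuous_apply _)

variable (R c k) in
/-- `blockGlue` as a homeomorphism. [folklore] -/
def blockGlueHomeomorph [TopologicalSpace R] (hk : k ≤ c + 1) :
    (BlockIdx (c + 1) k → R) × (RowBelow c k → R) ≃ₜ (BlockIdx (c + 2) k → R) where
  toEquiv := (blockGlue R c k hk).toEquiv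
  continuous_toFun := continuous_blockGlue R c k hk
  continuous_invFun := continuous_blockGlue_symm R c k hk

/-- **The translation `t(N, w)`**: `t(N, w)_i = ∑_{j ≥ k} N_{ij} w_j` for `i < k` — the effect of the
block `N ∈ 𝔫_k(GL_{c+1})` on the rows `< k` of a column whose rows `≥ k` are `w`. [folklore] -/
def blockTransl (N : BlockIdx (c + 1) k → R) (w : RowFrom c k → R) : RowBelow c k → R := fun i =>
  ∑ j : Fin (c + 1), if h : k ≤ (j : ℕ) then N ⟨(i.1, j), i.2, h⟩ * w ⟨j, not_lt.2 h⟩ else 0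

/-- Unfolding of `blockTransl`. [folklore] -/
theorem blockTransl_apply (N : BlockIdx (c + 1) k → R) (w : RowFrom c k → R) (i : RowBelow c k) :
    blockTransl N w i =
      ∑ j : Fin (c + 1), if h : k ≤ (j : ℕ) then N ⟨(i.1, j), i.2, h⟩ * w ⟨j, not_lt.2 h⟩ else 0 :=
  rfl

/-- `t(N, 0) = 0`. [folklore] -/
@[simp]
theorem blockTransl_zero_right (N : BlockIdx (c + 1) k → R) : blockTransl N (0 : RowFrom c k → R) = 0 := by
  funext i
  rw [blockTransl_apply, Pi.zero_apply]
  refine Finset.sum_eq_zero fun j _ => ?_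
  split_ifs <;> simp

/-- `t(N, w)` is continuous in `(N, w)`. [folklore] -/
theorem continuous_blockTransl [TopologicalSpace R] [IsTopologicalRing R] :
    Continuous fun q : (BlockIdx (c + 1) k → R) × (RowFrom c k → R) => blockTransl q.1 q.2 := by
  refine continuous_pi fun i => ?_
  simp only [blockTransl_apply]
  refine continuous_finsetSum _ fun j _ => ?_
  split_ifs
  · exact ((continuous_apply _).comp continuous_fst).mul ((continuous_apply _).comp continuous_snd)
  · exact continuous_const

end Glue

/-! ### Matrix identities -/

section Ring

variable {R : Type*} [CommRing R] {n c k : ℕ}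

/-- **Block form of `diag(γ, 1) · u(x)`**: `(γ, colVec (γ x); 0, 1)`. [folklore] -/
theorem coe_glCorner_mul_colUnipotent {m : ℕ} (h : m ≤ n) (γ : GL (Fin m) R) (x : Fin m → R) :
    ((glCorner R h γ * colUnipotent n h (Multiplicative.ofAdd x) : GL (Fin n) R) :
        Matrix (Fin n) (Fin n) R) =
      Matrix.reindex (finBlockEquiv h) (finBlockEquiv h)
        (Matrix.fromBlocks (γ : Matrix (Fin m) (Fin m) R)
          (colVec n ((γ : Matrix (Fin m) (Fin m) R) *ᵥ x)) 0 1) := by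
  rw [Units.val_mul, coe_glCorner, coe_colUnipotent]
  simp only [Matrix.reindex_apply, Matrix.submatrix_mul_equiv, Matrix.fromBlocks_multiply,
    Matrix.mul_zero, Matrix.zero_mul, add_zero, zero_add, Matrix.mul_one, mul_colVec]

/-- The matrix of `(1 + X)⁻¹` is `1 - X` (definitional). [folklore] -/
theorem coe_unipotentOfBlock_ofAdd_inv {m : ℕ} (X : blockNilpotent m k R) :
    (((unipotentOfBlock m k R (Multiplicative.ofAdd X))⁻¹ : GL (Fin m) R) : Matrix (Fin m) (Fin m) R) =
      1 - (X : Matrix (Fin m) (Fin m) R) :=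
  rfl

/-- **The block acts on a glued column through the translation**: `N · (a, w) = (t(N, w), 0)` for
`N ∈ 𝔫_k(GL_{c+1})` in box coordinates. [folklore] -/
theorem blockMatrixEquiv_mulVec_rowGlue (N : BlockIdx (c + 1) k → R) (a : RowBelow c k → R)
    (w : RowFrom c k → R) :
    ((blockMatrixEquiv R (c + 1) k N : blockNilpotent (c + 1) k R) : Matrix (Fin (c + 1)) (Fin (c + 1)) R) *ᵥ
        rowGlue R c k (a, w) =
      rowGlue R c k (blockTransl N w, 0) := by
  funext i
  simp only [Matrix.mulVec, dotProduct]
  by_cases hi : (i : ℕ) < k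
  · rw [rowGlue_apply_of_lt _ _ hi]
    dsimp only
    rw [blockTransl_apply]
    refine Finset.sum_congr rfl fun j _ => ?_
    rw [coe_blockMatrixEquiv_apply]
    by_cases hj : k ≤ (j : ℕ)
    · rw [dif_pos ⟨hi, hj⟩, dif_pos hj, rowGlue_apply_of_not_lt _ _ (not_lt.2 hj)]
    · rw [dif_neg (fun h => hj h.2), dif_neg hj, zero_mul]
  · rw [rowGlue_apply_of_not_lt _ _ hi]
    dsimp only
    rw [Pi.zero_apply]
    refine Finset.sum_eq_zero fun j _ => ?_
    rw [coe_blockMatrixEquiv_apply, dif_neg (fun h => hi h.1), zero_mul]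

/-- **Gluing is `diag(1 + N, 1) · u(b, 0)` in `GL_{c+2}`**: the block unipotent of the glued block
`[N, b]` is the corner of the block unipotent of `N` times the column unipotent of `(b, 0)`.
[folklore] -/
theorem unipotentOfBlock_blockGlue (hk : k ≤ c + 1) (N : BlockIdx (c + 1) k → R) (b : RowBelow c k → R) :
    unipotentOfBlock (c + 2) k R
        (Multiplicative.ofAdd (blockMatrixEquiv R (c + 2) k (blockGlue R c k hk (N, b)))) =
      glCorner R (Nat.le_succ (c + 1))
          (unipotentOfBlock (c + 1) k R (Multiplicative.ofAdd (blockMatrixEquiv R (c + 1) k N))) *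
        colUnipotent (c + 2) (Nat.le_succ (c + 1)) (Multiplicative.ofAdd (rowGlue R c k (b, 0))) := by
  refine Units.ext (Matrix.ext fun i j => ?_)
  rw [coe_glCorner_mul_colUnipotent]
  simp only [coe_unipotentOfBlock, toAdd_ofAdd]
  rw [Matrix.add_mulVec, Matrix.one_mulVec, blockMatrixEquiv_mulVec_rowGlue, blockTransl_zero_right,
    ← map_add, Prod.mk_add_mk, add_zero, add_zero, Matrix.add_apply, Matrix.one_apply,
    coe_blockMatrixEquiv_apply, Matrix.reindex_apply, Matrix.submatrix_apply]
  by_cases hi : (i : ℕ) < c + 1 <;> by_cases hj : (j : ℕ) < c + 1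
  · rw [finBlockEquiv_symm_of_lt _ i hi, finBlockEquiv_symm_of_lt _ j hj, Matrix.fromBlocks_apply₁₁,
      Matrix.add_apply, Matrix.one_apply, coe_blockMatrixEquiv_apply]
    congr 1
    · simp only [Fin.ext_iff]
    · by_cases h : (i : ℕ) < k ∧ k ≤ (j : ℕ)
      · rw [dif_pos h, dif_pos h, blockGlue_apply, dif_pos hj]
      · rw [dif_neg h, dif_neg h]
  · have hj' : (j : ℕ) = c + 1 := by have := j.isLt; omega
    rw [finBlockEquiv_symm_of_lt _ i hi, finBlockEquiv_symm_of_le _ j (not_lt.1 hj),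
      Matrix.fromBlocks_apply₁₂, colVec_apply, if_neg (show i ≠ j from fun e => by rw [e] at hi; exact hj hi),
      zero_add, if_pos (show (j : ℕ) - (c + 1) = 0 by omega), rowGlue_apply]
    by_cases hik : (i : ℕ) < k
    · rw [dif_pos hik, dif_pos ⟨hik, hj' ▸ hk⟩, blockGlue_apply, dif_neg hj]
    · simp only [dif_neg hik, dif_neg (show ¬((i : ℕ) < k ∧ k ≤ (j : ℕ)) from fun h => hik h.1),
        Pi.zero_apply]
  · rw [finBlockEquiv_symm_of_le _ i (not_lt.1 hi), finBlockEquiv_symm_of_lt _ j hj,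
      Matrix.fromBlocks_apply₂₁, Matrix.zero_apply, if_neg (fun e => by rw [e] at hi; exact hi hj),
      dif_neg (fun h => hi (lt_of_lt_of_le h.1 hk)), add_zero]
  · rw [finBlockEquiv_symm_of_le _ i (not_lt.1 hi), finBlockEquiv_symm_of_le _ j (not_lt.1 hj),
      Matrix.fromBlocks_apply₂₂, Matrix.one_apply, dif_neg (fun h => hi (lt_of_lt_of_le h.1 hk)), add_zero]
    have hij : i = j := Fin.ext (by have := i.isLt; have := j.isLt; omega)
    subst hij
    rw [if_pos rfl, if_pos rfl]

/-- **Gluing in `GL_n`**: `diag(1 + [N, b], 1_{n-c-2}) = diag(1 + N, 1_{n-c-1}) · u(b, 0)`. [folklore] -/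
theorem glCorner_unipotentOfBlock_blockGlue (hc : c + 1 ≤ n) (hc1 : c + 2 ≤ n) (hk : k ≤ c + 1)
    (N : BlockIdx (c + 1) k → R) (b : RowBelow c k → R) :
    glCorner R hc1 (unipotentOfBlock (c + 2) k R
        (Multiplicative.ofAdd (blockMatrixEquiv R (c + 2) k (blockGlue R c k hk (N, b))))) =
      glCorner R hc (unipotentOfBlock (c + 1) k R (Multiplicative.ofAdd (blockMatrixEquiv R (c + 1) k N))) *
        colUnipotent n hc (Multiplicative.ofAdd (rowGlue R c k (b, 0))) := by
  rw [unipotentOfBlock_blockGlue, map_mul, glCorner_glCorner hc hc1,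
    ← colUnipotent_eq_glCorner_colUnipotent hc hc1]

/-- **The key matrix identity of the inductive step**:
`u(a, w) · diag(1 + N, 1) = diag(1 + [N, a - t(N, w)], 1) · u(0, w)` in `GL_n(R)`. [folklore] -/
theorem colUnipotent_rowGlue_mul_glCorner (hc : c + 1 ≤ n) (hc1 : c + 2 ≤ n) (hk : k ≤ c + 1)
    (N : BlockIdx (c + 1) k → R) (a : RowBelow c k → R) (w : RowFrom c k → R) :
    colUnipotent n hc (Multiplicative.ofAdd (rowGlue R c k (a, w))) *
        glCorner R hc (unipotentOfBlock (c + 1) k R (Multiplicative.ofAdd (blockMatrixEquiv R (c + 1) k N))) =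
      glCorner R hc1 (unipotentOfBlock (c + 2) k R (Multiplicative.ofAdd
          (blockMatrixEquiv R (c + 2) k (blockGlue R c k hk (N, a - blockTransl N w))))) *
        colUnipotent n hc (Multiplicative.ofAdd (rowGlue R c k (0, w))) := by
  rw [colUnipotent_mul_glCorner, coe_unipotentOfBlock_ofAdd_inv, Matrix.sub_mulVec, Matrix.one_mulVec,
    blockMatrixEquiv_mulVec_rowGlue, ← map_sub, Prod.mk_sub_mk, sub_zero,
    glCorner_unipotentOfBlock_blockGlue hc hc1 hk, mul_assoc, ← colUnipotent_add, ← map_add,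
    Prod.mk_add_mk, add_zero, zero_add]

/-- **Translating the new column is a left column unipotent**:
`diag(1 + [N, a + κ], 1) = u(κ, 0) · diag(1 + [N, a], 1)`. [folklore] -/
theorem glCorner_unipotentOfBlock_blockGlue_add (hc : c + 1 ≤ n) (hc1 : c + 2 ≤ n) (hk : k ≤ c + 1)
    (N : BlockIdx (c + 1) k → R) (a κ : RowBelow c k → R) :
    glCorner R hc1 (unipotentOfBlock (c + 2) k R
        (Multiplicative.ofAdd (blockMatrixEquiv R (c + 2) k (blockGlue R c k hk (N, a + κ))))) =
      colUnipotent n hc (Multiplicative.ofAdd (rowGlue R c k (κ, 0))) *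
        glCorner R hc1 (unipotentOfBlock (c + 2) k R
          (Multiplicative.ofAdd (blockMatrixEquiv R (c + 2) k (blockGlue R c k hk (N, a))))) := by
  rw [glCorner_unipotentOfBlock_blockGlue hc hc1 hk, glCorner_unipotentOfBlock_blockGlue hc hc1 hk,
    ← mul_assoc, colUnipotent_mul_glCorner, coe_unipotentOfBlock_ofAdd_inv, Matrix.sub_mulVec,
    Matrix.one_mulVec, blockMatrixEquiv_mulVec_rowGlue, blockTransl_zero_right, ← map_sub,
    Prod.mk_sub_mk, sub_zero, sub_zero, mul_assoc, ← colUnipotent_add, ← map_add, Prod.mk_add_mk,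
    add_zero, add_comm κ a]

variable [TopologicalSpace R] [IsTopologicalRing R]

/-- `X ↦ 1 + X : 𝔫_k(R) → GL_m(R)` is continuous (entries `1 ± X`). [folklore] -/
theorem continuous_ofAdd_unipotentOfBlock {m : ℕ} :
    Continuous fun X : blockNilpotent m k R => unipotentOfBlock m k R (Multiplicative.ofAdd X) := by
  refine Units.continuous_iff.2 ⟨?_, ?_⟩
  · exact continuous_const.add continuous_subtype_val
  · exact continuous_const.sub continuous_subtype_val

omit [IsTopologicalRing R] in
/-- The corner embedding `glCorner` is continuous. [folklore] -/
theorem continuous_glCorner {m : ℕ} (h : m ≤ n) : Continuous (glCorner R h) := by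
  have hc : ∀ {f : GL (Fin m) R → Matrix (Fin m) (Fin m) R}, Continuous f → Continuous fun g =>
      Matrix.reindex (finBlockEquiv h) (finBlockEquiv h)
        (Matrix.fromBlocks (f g) 0 0 (1 : Matrix (Fin (n - m)) (Fin (n - m)) R)) :=
    fun hf => Continuous.matrix_reindex
      (Continuous.matrix_fromBlocks hf continuous_const continuous_const continuous_const) _ _
  refine Units.continuous_iff.2 ⟨(hc Units.continuous_val).congr fun g => (coe_glCorner h g).symm,
    (hc Units.continuous_coe_inv).congr fun g => ?_⟩
  rw [← coe_glCorner, map_inv]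

end Ring

/-! ### The inductive step -/

section Adelic

variable (K : Type) [Field K] [NumberField K] {n c k : ℕ} [MeasurableSpace (AdeleRing (𝓞 K) K)]
  [BorelSpace (AdeleRing (𝓞 K) K)]

omit [MeasurableSpace (AdeleRing (𝓞 K) K)] [BorelSpace (AdeleRing (𝓞 K) K)] in
/-- The pairing with `e = lastVec` is the last coordinate: `∑_i e_i v_i = v_c`. [folklore] -/
theorem sum_lastVec_mul (v : Fin (c + 1) → AdeleRing (𝓞 K) K) :
    ∑ i, algebraMap K (AdeleRing (𝓞 K) K) (lastVec c K i) * v i = v (Fin.last c) := by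
  rw [Finset.sum_eq_single (Fin.last c)]
  · simp [lastVec]
  · intro i _ hi
    simp [lastVec, hi]
  · intro h; exact absurd (Finset.mem_univ _) h

omit [MeasurableSpace (AdeleRing (𝓞 K) K)] [BorelSpace (AdeleRing (𝓞 K) K)] in
/-- `rowGlue` commutes with the diagonal embedding of `K`. [folklore] -/
theorem rowGlue_algebraMap (κ : RowBelow c k → K) :
    (fun i => algebraMap K (AdeleRing (𝓞 K) K) (rowGlue K c k (κ, 0) i)) =
      rowGlue (AdeleRing (𝓞 K) K) c k (fun i => algebraMap K (AdeleRing (𝓞 K) K) (κ i), 0) := by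
  funext i
  rw [rowGlue_apply, rowGlue_apply]
  split_ifs
  · rfl
  · simp

omit [MeasurableSpace (AdeleRing (𝓞 K) K)] [BorelSpace (AdeleRing (𝓞 K) K)] in
/-- Tate's box of `𝔸_K^{c+1}` is glued from the boxes of the row pieces. [folklore] -/
theorem rowGlue_preimage_piFundamentalDomain (c k : ℕ) :
    rowGlue (AdeleRing (𝓞 K) K) c k ⁻¹' piFundamentalDomain K (Fin (c + 1)) =
      piFundamentalDomain K (RowBelow c k) ×ˢ piFundamentalDomain K (RowFrom c k) := by
  ext q
  simp only [Set.mem_preimage, piFundamentalDomain, Set.mem_univ_pi, Set.mem_prod]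
  constructor
  · intro h
    refine ⟨fun i => ?_, fun i => ?_⟩
    · have := h i.1
      rwa [rowGlue_apply_of_lt _ _ i.2] at this
    · have := h i.1
      rwa [rowGlue_apply_of_not_lt _ _ i.2] at this
  · rintro ⟨h1, h2⟩ i
    rw [rowGlue_apply]
    split_ifs with hi
    · exact h1 _
    · exact h2 _

omit [MeasurableSpace (AdeleRing (𝓞 K) K)] [BorelSpace (AdeleRing (𝓞 K) K)] in
/-- Tate's box of the block of `GL_{c+2}` is glued from the box of the block of `GL_{c+1}` and the
box of the short column. [folklore] -/
theorem blockGlue_preimage_piFundamentalDomain (hk : k ≤ c + 1) :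
    blockGlue (AdeleRing (𝓞 K) K) c k hk ⁻¹' piFundamentalDomain K (BlockIdx (c + 2) k) =
      piFundamentalDomain K (BlockIdx (c + 1) k) ×ˢ piFundamentalDomain K (RowBelow c k) := by
  ext q
  simp only [Set.mem_preimage, piFundamentalDomain, Set.mem_univ_pi, Set.mem_prod]
  constructor
  · intro h
    refine ⟨fun p => ?_, fun i => ?_⟩
    · have := h ⟨(Fin.castSucc p.1.1, Fin.castSucc p.1.2), p.2⟩
      rwa [blockGlue_apply_castSucc] at this
    · have := h ⟨(Fin.castSucc i.1, Fin.last (c + 1)), i.2, hk⟩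
      rwa [blockGlue_apply_last] at this
  · rintro ⟨h1, h2⟩ p
    rw [blockGlue_apply]
    split_ifs with hJ
    · exact h1 _
    · exact h2 _

variable {K}

/-- A continuous function on a product of two adelic boxes is integrable there, for measures
finite on the boxes. [folklore] -/
theorem integrableOn_prod_piFundamentalDomain {ι₁ ι₂ : Type} [Fintype ι₁] [Fintype ι₂]
    (μ₁ : Measure (ι₁ → AdeleRing (𝓞 K) K)) (μ₂ : Measure (ι₂ → AdeleRing (𝓞 K) K)) [SFinite μ₂]
    (h₁ : μ₁ (piFundamentalDomain K ι₁) ≠ ⊤) (h₂ : μ₂ (piFundamentalDomain K ι₂) ≠ ⊤)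
    {E : Type*} [NormedAddCommGroup E]
    {F : (ι₁ → AdeleRing (𝓞 K) K) × (ι₂ → AdeleRing (𝓞 K) K) → E} (hF : Continuous F) :
    IntegrableOn F (piFundamentalDomain K ι₁ ×ˢ piFundamentalDomain K ι₂) (μ₁.prod μ₂) := by
  haveI := t2Space_adeleRing K
  haveI := secondCountableTopology_adeleRing K
  haveI : BorelSpace (ι₁ → AdeleRing (𝓞 K) K) := Pi.borelSpace
  haveI : BorelSpace (ι₂ → AdeleRing (𝓞 K) K) := Pi.borelSpace
  refine hF.continuousOn.integrableOn_of_subset_isCompact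
    ((isCompact_closure_piFundamentalDomain K ι₁).prod (isCompact_closure_piFundamentalDomain K ι₂))
    ((measurableSet_piFundamentalDomain K ι₁).prod (measurableSet_piFundamentalDomain K ι₂))
    (Set.prod_mono subset_closure subset_closure) ?_
  rw [Measure.prod_prod]
  exact ENNReal.mul_ne_top h₁ h₂

/-- **The big block constant term in glued coordinates.** If `TowerCusp (c + 2 ≤ n) φ`, then for
Haar measures `ν₁` on the box coordinates of `𝔫_k(GL_{c+1})` and `νa` on `𝔸_K^{<k}`, every `z`
and `0 < k ≤ c + 1`:
`∫_{N ∈ D} ∫_{a ∈ D} φ(diag(1 + [N, a], 1) z) dνa dν₁ = 0` — the constant term along `𝔫_k(GL_{c+2})`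
for the Haar measure transported along `blockGlue`, written as an iterated integral (Fubini on the
finite boxes; `φ` continuous). [cite: CogdellAnalyticTheory2004, §1.1] -/
theorem setIntegral_setIntegral_blockGlue_eq_zero (hc1 : c + 2 ≤ n) (hk0 : 0 < k) (hk : k ≤ c + 1)
    {φ : GL (Fin n) (AdeleRing (𝓞 K) K) → ℂ} (hφc : Continuous φ) (hTC : TowerCusp hc1 φ)
    (ν₁ : Measure (BlockIdx (c + 1) k → AdeleRing (𝓞 K) K)) [ν₁.IsAddHaarMeasure]
    (νa : Measure (RowBelow c k → AdeleRing (𝓞 K) K)) [νa.IsAddHaarMeasure]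
    (z : GL (Fin n) (AdeleRing (𝓞 K) K)) :
    ∫ N in piFundamentalDomain K (BlockIdx (c + 1) k), ∫ a in piFundamentalDomain K (RowBelow c k),
      φ (glCorner (AdeleRing (𝓞 K) K) hc1 (unipotentOfBlock (c + 2) k (AdeleRing (𝓞 K) K)
        (Multiplicative.ofAdd (blockMatrixEquiv (AdeleRing (𝓞 K) K) (c + 2) k
          (blockGlue (AdeleRing (𝓞 K) K) c k hk (N, a))))) * z) ∂νa ∂ν₁ = 0 := by
  haveI := locallyCompactSpace_adeleRing' K
  haveI := secondCountableTopology_adeleRing K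
  haveI := t2Space_adeleRing K
  haveI : BorelSpace (BlockIdx (c + 1) k → AdeleRing (𝓞 K) K) := Pi.borelSpace
  haveI : BorelSpace (BlockIdx (c + 2) k → AdeleRing (𝓞 K) K) := Pi.borelSpace
  haveI : BorelSpace (RowBelow c k → AdeleRing (𝓞 K) K) := Pi.borelSpace
  set eB := blockGlue (AdeleRing (𝓞 K) K) c k hk with heB
  set ν₂ : Measure (BlockIdx (c + 2) k → AdeleRing (𝓞 K) K) := Measure.map eB (ν₁.prod νa) with hν₂
  haveI : ν₂.IsAddHaarMeasure :=
    AddEquiv.isAddHaarMeasure_map _ eB (continuous_blockGlue _ c k hk) (continuous_blockGlue_symm _ c k hk)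
  have hmp : MeasurePreserving eB (ν₁.prod νa) ν₂ := ⟨(continuous_blockGlue _ c k hk).measurable, rfl⟩
  have hme : MeasurableEmbedding eB := (blockGlueHomeomorph (AdeleRing (𝓞 K) K) c k hk).measurableEmbedding
  have h0 := hTC k hk0 (by omega) ν₂ inferInstance z
  rw [blockCT_apply, ← hmp.setIntegral_preimage_emb hme, heB, blockGlue_preimage_piFundamentalDomain K hk]
    at h0
  set F : (BlockIdx (c + 1) k → AdeleRing (𝓞 K) K) × (RowBelow c k → AdeleRing (𝓞 K) K) → ℂ :=
    fun q => φ (glCorner (AdeleRing (𝓞 K) K) hc1 (unipotentOfBlock (c + 2) k (AdeleRing (𝓞 K) K)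
      (Multiplicative.ofAdd (blockMatrixEquiv (AdeleRing (𝓞 K) K) (c + 2) k
        (blockGlue (AdeleRing (𝓞 K) K) c k hk q)))) * z) with hF
  have hFc : Continuous F := by
    refine hφc.comp (Continuous.mul ?_ continuous_const)
    exact (continuous_glCorner hc1).comp (continuous_ofAdd_unipotentOfBlock.comp
      ((continuous_blockMatrixEquiv (c + 2) k).comp (continuous_blockGlue _ c k hk)))
  have hfin₁ : ν₁ (piFundamentalDomain K (BlockIdx (c + 1) k)) ≠ ⊤ :=
    ((measure_mono subset_closure).trans_lt (isCompact_closure_piFundamentalDomain K _).measure_lt_top).ne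
  have hfina : νa (piFundamentalDomain K (RowBelow c k)) ≠ ⊤ :=
    ((measure_mono subset_closure).trans_lt (isCompact_closure_piFundamentalDomain K _).measure_lt_top).ne
  have hint := integrableOn_prod_piFundamentalDomain ν₁ νa hfin₁ hfina hFc
  calc _ = ∫ q in piFundamentalDomain K (BlockIdx (c + 1) k) ×ˢ piFundamentalDomain K (RowBelow c k),
        F q ∂(ν₁.prod νa) := (setIntegral_prod F hint).symm
    _ = 0 := h0

/-- **The new column integral is translation invariant.** For `φ` continuous and left invariant
under `u(K^{c+1})`, the box integral `∫_{a ∈ D} φ(diag(1 + [N, a + s], 1) z) dνa` does not depend on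
`s ∈ 𝔸_K^{<k}`: `a ↦ φ(diag(1 + [N, a], 1) z)` is `K^{<k}`-periodic
(`glCorner_unipotentOfBlock_blockGlue_add`), and `setIntegral_piFundamentalDomain_comp_add` applies.
[folklore] -/
theorem setIntegral_blockGlue_add (hc : c + 1 ≤ n) (hc1 : c + 2 ≤ n) (hk : k ≤ c + 1)
    {φ : GL (Fin n) (AdeleRing (𝓞 K) K) → ℂ} (hφc : Continuous φ)
    (hper : ∀ (κ : Fin (c + 1) → K) (x : GL (Fin n) (AdeleRing (𝓞 K) K)),
      φ (colUnipotent n hc (Multiplicative.ofAdd fun i => algebraMap K (AdeleRing (𝓞 K) K) (κ i)) * x) =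
        φ x)
    (νa : Measure (RowBelow c k → AdeleRing (𝓞 K) K)) [νa.IsAddHaarMeasure]
    (N : BlockIdx (c + 1) k → AdeleRing (𝓞 K) K) (s : RowBelow c k → AdeleRing (𝓞 K) K)
    (z : GL (Fin n) (AdeleRing (𝓞 K) K)) :
    ∫ a in piFundamentalDomain K (RowBelow c k),
      φ (glCorner (AdeleRing (𝓞 K) K) hc1 (unipotentOfBlock (c + 2) k (AdeleRing (𝓞 K) K)
        (Multiplicative.ofAdd (blockMatrixEquiv (AdeleRing (𝓞 K) K) (c + 2) k
          (blockGlue (AdeleRing (𝓞 K) K) c k hk (N, a + s))))) * z) ∂νa =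
    ∫ a in piFundamentalDomain K (RowBelow c k),
      φ (glCorner (AdeleRing (𝓞 K) K) hc1 (unipotentOfBlock (c + 2) k (AdeleRing (𝓞 K) K)
        (Multiplicative.ofAdd (blockMatrixEquiv (AdeleRing (𝓞 K) K) (c + 2) k
          (blockGlue (AdeleRing (𝓞 K) K) c k hk (N, a))))) * z) ∂νa := by
  refine setIntegral_piFundamentalDomain_comp_add νa s
    (F := fun a => φ (glCorner (AdeleRing (𝓞 K) K) hc1 (unipotentOfBlock (c + 2) k (AdeleRing (𝓞 K) K)
        (Multiplicative.ofAdd (blockMatrixEquiv (AdeleRing (𝓞 K) K) (c + 2) k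
          (blockGlue (AdeleRing (𝓞 K) K) c k hk (N, a))))) * z)) ?_ fun a κ => ?_
  · refine hφc.comp (Continuous.mul ?_ continuous_const)
    exact (continuous_glCorner hc1).comp (continuous_ofAdd_unipotentOfBlock.comp
      ((continuous_blockMatrixEquiv (c + 2) k).comp ((continuous_blockGlue _ c k hk).comp
        (continuous_const.prodMk continuous_id))))
  · rw [glCorner_unipotentOfBlock_blockGlue_add hc hc1 hk, ← rowGlue_algebraMap, mul_assoc, hper]

/-- **The inductive step of the cusp invariant** (Cogdell (2004), proof of Thm. 1.1). Let
`φ : GL_n(𝔸_K) → ℂ` be continuous, left invariant under the rational column group `u(K^{c+1})`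
(`u = colUnipotent n (c + 1 ≤ n)`, the last column of the corner `GL_{c+2}`), and suppose all block
constant terms of `φ` inside the corner `GL_{c+2}` vanish (`TowerCusp (c + 2 ≤ n) φ`). Then all block
constant terms of the column coefficient `Φ = φ_e = colCoeff (c + 1 ≤ n) ν φ e` inside the corner
`GL_{c+1}` vanish: `TowerCusp (c + 1 ≤ n) Φ`, for every additive Haar measure `ν` on `𝔸_K^{c+1}`.
Proof: see the module docstring (`u(a, w) diag(1 + N, 1) = diag(1 + [N, a - t(N, w)], 1) u(0, w)`,
translation invariance of the `a`-integral, Fubini, and the hypothesis at `u(0, w) y`).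
[cite: CogdellAnalyticTheory2004, §1.1] -/
theorem towerCusp_colCoeff (hc : c + 1 ≤ n) (hc1 : c + 2 ≤ n)
    {φ : GL (Fin n) (AdeleRing (𝓞 K) K) → ℂ} (hφc : Continuous φ)
    (hper : ∀ (κ : Fin (c + 1) → K) (x : GL (Fin n) (AdeleRing (𝓞 K) K)),
      φ (colUnipotent n hc (Multiplicative.ofAdd fun i => algebraMap K (AdeleRing (𝓞 K) K) (κ i)) * x) =
        φ x)
    (hTC : TowerCusp hc1 φ) (ν : Measure (Fin (c + 1) → AdeleRing (𝓞 K) K)) [ν.IsAddHaarMeasure] :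
    TowerCusp hc (fun y => colCoeff hc ν φ (lastVec c K) y) := by
  intro k hk0 hkc ν₁ hν₁ y
  haveI := hν₁
  haveI := locallyCompactSpace_adeleRing' K
  haveI := secondCountableTopology_adeleRing K
  haveI := t2Space_adeleRing K
  haveI : BorelSpace (Fin (c + 1) → AdeleRing (𝓞 K) K) := Pi.borelSpace
  haveI : BorelSpace (BlockIdx (c + 1) k → AdeleRing (𝓞 K) K) := Pi.borelSpace
  haveI : BorelSpace (RowBelow c k → AdeleRing (𝓞 K) K) := Pi.borelSpace
  haveI : BorelSpace (RowFrom c k → AdeleRing (𝓞 K) K) := Pi.borelSpace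
  have hk : k ≤ c + 1 := hkc.le
  have hlast : ¬((Fin.last c : Fin (c + 1)) : ℕ) < k := by simp only [Fin.val_last]; omega
  -- the boxes
  set DB := piFundamentalDomain K (BlockIdx (c + 1) k) with hDB
  set DA := piFundamentalDomain K (RowBelow c k) with hDA
  set DW := piFundamentalDomain K (RowFrom c k) with hDW
  have hDBm : MeasurableSet DB := measurableSet_piFundamentalDomain K _
  have hDWm : MeasurableSet DW := measurableSet_piFundamentalDomain K _
  -- Haar measures on the row pieces and the glued column measure
  set νa : Measure (RowBelow c k → AdeleRing (𝓞 K) K) := Measure.addHaar with hνa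
  set νw : Measure (RowFrom c k → AdeleRing (𝓞 K) K) := Measure.addHaar with hνw
  set ν₀ : Measure (Fin (c + 1) → AdeleRing (𝓞 K) K) :=
    Measure.map (rowGlue (AdeleRing (𝓞 K) K) c k) (νa.prod νw) with hν₀
  haveI : ν₀.IsAddHaarMeasure :=
    AddEquiv.isAddHaarMeasure_map _ (rowGlue (AdeleRing (𝓞 K) K) c k) (continuous_rowGlue _ c k)
      (continuous_rowGlue_symm _ c k)
  have hmpR : MeasurePreserving (rowGlue (AdeleRing (𝓞 K) K) c k) (νa.prod νw) ν₀ :=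
    ⟨(continuous_rowGlue _ c k).measurable, rfl⟩
  have hmeR : MeasurableEmbedding (rowGlue (AdeleRing (𝓞 K) K) c k) :=
    (rowGlueHomeomorph (AdeleRing (𝓞 K) K) c k).measurableEmbedding
  have hDBfin : ν₁ DB < ⊤ :=
    (measure_mono subset_closure).trans_lt (isCompact_closure_piFundamentalDomain K _).measure_lt_top
  have hDAfin : νa DA < ⊤ :=
    (measure_mono subset_closure).trans_lt (isCompact_closure_piFundamentalDomain K _).measure_lt_top
  have hDWfin : νw DW < ⊤ :=
    (measure_mono subset_closure).trans_lt (isCompact_closure_piFundamentalDomain K _).measure_lt_top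
  haveI : IsFiniteMeasure (ν₁.restrict DB) := isFiniteMeasure_restrict.2 hDBfin.ne
  haveI : IsFiniteMeasure (νa.restrict DA) := isFiniteMeasure_restrict.2 hDAfin.ne
  haveI : IsFiniteMeasure (νw.restrict DW) := isFiniteMeasure_restrict.2 hDWfin.ne
  -- opaque abbreviations for the matrices and the character
  obtain ⟨Gm, hGm⟩ : ∃ Gm : (BlockIdx (c + 1) k → AdeleRing (𝓞 K) K) → (RowBelow c k → AdeleRing (𝓞 K) K) →
      GL (Fin n) (AdeleRing (𝓞 K) K), ∀ N a, Gm N a =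
        glCorner (AdeleRing (𝓞 K) K) hc1 (unipotentOfBlock (c + 2) k (AdeleRing (𝓞 K) K)
          (Multiplicative.ofAdd (blockMatrixEquiv (AdeleRing (𝓞 K) K) (c + 2) k
            (blockGlue (AdeleRing (𝓞 K) K) c k hk (N, a))))) := ⟨_, fun _ _ => rfl⟩
  obtain ⟨uW, huW⟩ : ∃ uW : (RowFrom c k → AdeleRing (𝓞 K) K) → GL (Fin n) (AdeleRing (𝓞 K) K), ∀ w, uW w =
      colUnipotent n hc (Multiplicative.ofAdd (rowGlue (AdeleRing (𝓞 K) K) c k (0, w))) := ⟨_, fun _ => rfl⟩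
  obtain ⟨χ, hχ⟩ : ∃ χ : (RowFrom c k → AdeleRing (𝓞 K) K) → ℂ, ∀ w, χ w =
      conj (adeleAddChar K (w ⟨Fin.last c, hlast⟩) : ℂ) := ⟨_, fun _ => rfl⟩
  have hGmc : Continuous fun q : (BlockIdx (c + 1) k → AdeleRing (𝓞 K) K) ×
      (RowBelow c k → AdeleRing (𝓞 K) K) => Gm q.1 q.2 := by
    simp only [hGm]
    exact (continuous_glCorner hc1).comp (continuous_ofAdd_unipotentOfBlock.comp
      ((continuous_blockMatrixEquiv (c + 2) k).comp (continuous_blockGlue _ c k hk)))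
  have huWc : Continuous uW := by
    rw [show uW = _ from funext huW]
    exact (continuous_colUnipotent hc).comp ((continuous_rowGlue _ c k).comp
      (continuous_const.prodMk continuous_id))
  have hχc : Continuous χ := by
    rw [show χ = _ from funext hχ]
    exact Complex.continuous_conj.comp (continuous_subtype_val.comp ((continuous_adeleAddChar K).comp
      (continuous_apply _)))
  have hχn : ∀ w, ‖χ w‖ = 1 := fun w => by rw [hχ, Complex.norm_conj, Circle.norm_coe]
  -- (★): the big block constant term vanishes, in glued coordinates
  have hstar : ∀ w, ∫ N in DB, ∫ a in DA, φ (Gm N a * (uW w * y)) ∂νa ∂ν₁ = 0 := by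
    intro w
    simp only [hGm]
    exact setIntegral_setIntegral_blockGlue_eq_zero hc1 hk0 hk hφc hTC ν₁ νa (uW w * y)
  -- Step 1: the coefficient at `diag(1 + N, 1) y` as an iterated integral over `w` and `a`
  have hstep1 : ∀ N : BlockIdx (c + 1) k → AdeleRing (𝓞 K) K,
      colCoeff hc ν φ (lastVec c K) (glCorner (AdeleRing (𝓞 K) K) hc
        (unipotentOfBlock (c + 1) k (AdeleRing (𝓞 K) K)
          (Multiplicative.ofAdd (blockMatrixEquiv (AdeleRing (𝓞 K) K) (c + 1) k N))) * y) =
      ((ν₀ (piFundamentalDomain K (Fin (c + 1)))).toReal⁻¹ : ℝ) •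
        ∫ w in DW, χ w * ∫ a in DA, φ (Gm N a * (uW w * y)) ∂νa ∂νw := by
    intro N
    rw [colCoeff_eq_of_isAddHaarMeasure hc ν₀ ν, colCoeff_apply]
    congr 1
    rw [← hmpR.setIntegral_preimage_emb hmeR, rowGlue_preimage_piFundamentalDomain K c k]
    -- pointwise: the character and the matrix identity
    have hpt : ∀ q : (RowBelow c k → AdeleRing (𝓞 K) K) × (RowFrom c k → AdeleRing (𝓞 K) K),
        conj (adeleAddChar K (∑ i, algebraMap K (AdeleRing (𝓞 K) K) (lastVec c K i) *
            rowGlue (AdeleRing (𝓞 K) K) c k q i) : ℂ) *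
          φ (colUnipotent n hc (Multiplicative.ofAdd (rowGlue (AdeleRing (𝓞 K) K) c k q)) *
            (glCorner (AdeleRing (𝓞 K) K) hc (unipotentOfBlock (c + 1) k (AdeleRing (𝓞 K) K)
              (Multiplicative.ofAdd (blockMatrixEquiv (AdeleRing (𝓞 K) K) (c + 1) k N))) * y)) =
        χ q.2 * φ (Gm N (q.1 - blockTransl N q.2) * (uW q.2 * y)) := by
      rintro ⟨a, w⟩
      rw [hχ, hGm, huW, sum_lastVec_mul, rowGlue_apply_of_not_lt _ (Fin.last c) hlast,
        ← mul_assoc (colUnipotent n hc _), colUnipotent_rowGlue_mul_glCorner hc hc1 hk, mul_assoc]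
    simp_rw [hpt]
    -- iterate: first `w`, then `a`
    have hint : IntegrableOn (fun q : (RowBelow c k → AdeleRing (𝓞 K) K) × (RowFrom c k → AdeleRing (𝓞 K) K) =>
        χ q.2 * φ (Gm N (q.1 - blockTransl N q.2) * (uW q.2 * y))) (DA ×ˢ DW) (νa.prod νw) := by
      refine integrableOn_prod_piFundamentalDomain νa νw hDAfin.ne hDWfin.ne ?_
      refine (hχc.comp continuous_snd).mul (hφc.comp (Continuous.mul ?_ ((huWc.comp continuous_snd).mul
        continuous_const)))
      exact hGmc.comp (Continuous.prodMk continuous_const (continuous_fst.sub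
        (continuous_blockTransl.comp (continuous_const.prodMk continuous_snd))))
    rw [IntegrableOn, ← Measure.prod_restrict] at hint
    rw [← Measure.prod_restrict, integral_prod_symm _ hint]
    refine integral_congr_ae (Filter.Eventually.of_forall fun w => ?_)
    simp only [integral_const_mul]
    congr 1
    -- translation invariance in `a`
    simp only [hGm, sub_eq_add_neg]
    exact setIntegral_blockGlue_add hc hc1 hk hφc hper νa N _ (uW w * y)
  -- Step 2: exchange the `N`- and `w`-integrals (Fubini; the integrand is bounded on the boxes)
  obtain ⟨M, hM⟩ : ∃ M, ∀ N ∈ DB, ∀ a ∈ DA, ∀ w ∈ DW, ‖φ (Gm N a * (uW w * y))‖ ≤ M := by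
    have hΘc : Continuous fun q : (BlockIdx (c + 1) k → AdeleRing (𝓞 K) K) ×
        ((RowBelow c k → AdeleRing (𝓞 K) K) × (RowFrom c k → AdeleRing (𝓞 K) K)) =>
        φ (Gm q.1 q.2.1 * (uW q.2.2 * y)) :=
      hφc.comp ((hGmc.comp (continuous_fst.prodMk (continuous_fst.comp continuous_snd))).mul
        ((huWc.comp (continuous_snd.comp continuous_snd)).mul continuous_const))
    have hcpt : IsCompact (closure DB ×ˢ (closure DA ×ˢ closure DW)) :=
      (isCompact_closure_piFundamentalDomain K _).prod
        ((isCompact_closure_piFundamentalDomain K _).prod (isCompact_closure_piFundamentalDomain K _))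
    obtain ⟨M, hM⟩ := hcpt.exists_bound_of_continuousOn hΘc.continuousOn
    exact ⟨M, fun N hN a ha w hw => hM (N, (a, w)) ⟨subset_closure hN, subset_closure ha, subset_closure hw⟩⟩
  have hIbd : ∀ N ∈ DB, ∀ w ∈ DW, ‖∫ a in DA, φ (Gm N a * (uW w * y)) ∂νa‖ ≤ M * νa.real DA :=
    fun N hN w hw => norm_setIntegral_le_of_norm_le_const hDAfin fun a ha => hM N hN a ha w hw
  have hswap : ∫ N in DB, ∫ w in DW, χ w * ∫ a in DA, φ (Gm N a * (uW w * y)) ∂νa ∂νw ∂ν₁ =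
      ∫ w in DW, ∫ N in DB, χ w * ∫ a in DA, φ (Gm N a * (uW w * y)) ∂νa ∂ν₁ ∂νw := by
    refine integral_integral_swap ?_
    have hmeas : AEStronglyMeasurable
        (uncurry fun (N : BlockIdx (c + 1) k → AdeleRing (𝓞 K) K) (w : RowFrom c k → AdeleRing (𝓞 K) K) =>
          χ w * ∫ a in DA, φ (Gm N a * (uW w * y)) ∂νa)
        ((ν₁.restrict DB).prod (νw.restrict DW)) := by
      refine ((hχc.comp continuous_snd).aestronglyMeasurable).mul ?_
      have hF : Continuous fun q : ((BlockIdx (c + 1) k → AdeleRing (𝓞 K) K) ×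
          (RowFrom c k → AdeleRing (𝓞 K) K)) × (RowBelow c k → AdeleRing (𝓞 K) K) =>
          φ (Gm q.1.1 q.2 * (uW q.1.2 * y)) :=
        hφc.comp ((hGmc.comp ((continuous_fst.comp continuous_fst).prodMk continuous_snd)).mul
          ((huWc.comp (continuous_snd.comp continuous_fst)).mul continuous_const))
      exact (hF.stronglyMeasurable.integral_prod_right' (ν := νa.restrict DA)).aestronglyMeasurable
    refine Integrable.mono' (integrable_const (M * νa.real DA)) hmeas ?_
    rw [Measure.prod_restrict]
    refine (ae_restrict_iff' (hDBm.prod hDWm)).2 (Filter.Eventually.of_forall fun q hq => ?_)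
    show ‖χ q.2 * ∫ a in DA, φ (Gm q.1 a * (uW q.2 * y)) ∂νa‖ ≤ M * νa.real DA
    rw [norm_mul, hχn, one_mul]
    exact hIbd q.1 hq.1 q.2 hq.2
  -- assembly
  rw [blockCT_apply]
  simp_rw [hstep1]
  rw [integral_smul, hswap]
  simp_rw [integral_const_mul, hstar, mul_zero, integral_zero, smul_zero]

end Adelic

end Literature.NumberTheory.Automorphic
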